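import Summits.NavierStokesRegularity.NavierStokesRegularity.Theses.PalasekTowerBreakdown
import Summits.NavierStokesRegularity.FluidComputer.PalasekTowerRegisterGlobalFloorsAtSlice
import Summits.NavierStokesRegularity.FluidComputer.PalasekTowerRegisterGlobalCoreFlux

/-!
# NavierStokesRegularity — route `PalasekTowerBreakdown`, item `HeredityAtOne`: the three floor stubs as
# properties of the level-1 SLICE under the free Navier–Stokes flow, and the flux form of the core stub, by name

Supports `stmt-NavierStokesRegularity-19249` (`HeredityAtOne`; it does NOT close it and nobody claims it here).
Cell `ns-blowup`, seat `ns-palasek-19249-p2` (D-0081 §C stub-worker; registered line birth v3 2d6b5976e149bfa1: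
stubs `stub_apriori_ceiling_at_one : AprioriCeilingAt 1` (lead ecbridge-1 g6), `stub_speed_floor_at_one :
SpeedFloorAt 1`, `stub_strain_floor_at_one : StrainFloorAt 1`, `stub_core_floor_at_one : CoreFloorAt 1`).
LABEL: E–C typing (pure glue over the landed register files `FluidComputer/PalasekTowerRegisterGlobalFloorsAtSlice`
(p459039: `SliceRun`, `readoutAt_iff_sliceRun`) and `…CoreFlux` (flux form of the core clause), by name on the
route decls). WHAT THIS IS NOT: not NS — no stage, tower or instance is constructed; the item and its stubs are
OPEN and appear only inside equivalences / implications.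

* `palasekTowerBreakdown_heredityAtOne_iff_apriori_and_sliceFloors` — the item, no hypothesis, as «no overshoot»
  ∧ three statements about the FREE Navier–Stokes flow over the fixed window `W₁ = τ₂ − τ₁ = (253/25)·log N₂/A₁`
  from the SLICE `s.u τ₁` of every registered level-1 stage: every unforced finite-energy classical run from the
  slice staying `≤ (5/3)·Y₂` ends, in the ball, with (i) speed `≥ Y₂`, (ii) strain `≥ A₂`, (iii) an `N₂`-core.
  The forced history `[0, τ₁]` enters only by deciding WHICH slices are registered (item 19179's question);
* `palasekTowerBreakdown_heredityAtOne_sliceLetter` — under the item, every tame free run from a registered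
  level-1 slice ends with the level-2 LETTER (`readoutFloorsAt_one_iff_sliceRun`);
* `palasekTowerBreakdown_not_heredityAtOne_of_lazy_slice` — refutation template, slice form: ONE registered
  level-1 stage + ONE tame free run from its slice missing the level-2 letter refute the item;
* `palasekTowerBreakdown_heredityAtOne_of_apriori_speed_strain_vorticityDisc` — the item from «no overshoot»,
  the speed and strain stubs, and the FLUX FORM of the core stub (a disc of radius `1/N₂` centred in the ball
  with normal vorticity `≥ A₂/(4π) ≈ 4.0·10⁵` at `τ₂` on every tame continuation;
  `coreFloorAt_one_of_vorticityDisc`: Stokes on the disc, rim wound four times).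

References: S. Palasek, arXiv:2605.13827 §4 [cite: Palasek2026ElementaryModel, §4]; H. Sohr, *The Navier–Stokes
Equations*, Birkhäuser 2001, Ch. V Thm. 1.5.1 [cite: Sohr2001, Ch. V Thm. 1.5.1]; A. J. Majda, A. L. Bertozzi,
*Vorticity and Incompressible Flow*, CUP 2002, §1.6 [cite: MajdaBertozziCUP2002, §1.6].
-/

-- `Summit.<Summit>.<Problem>` is the tree's mandated summit-side namespace (CONVENTIONS §2); for this
-- single-conjunct summit the two coincide, so the duplicate is deliberate.
set_option linter.dupNamespace false

namespace Summit.NavierStokesRegularity.NavierStokesRegularity.Theorems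

open Set MeasureTheory Real
open scoped ENNReal ContDiff RealInnerProductSpace
open Literature.Analysis.FluidPDE
open Summit.NavierStokesRegularity.NavierStokesRegularity.Theses
open Summit.NavierStokesRegularity.FluidComputer.PalasekTowerClayBridge

/-- **Item `HeredityAtOne` ⇔ no overshoot ∧ three FREE-RUN floors on the registered level-1 slices — no
hypothesis.** `PalasekTowerBreakdown.HeredityAtOne` holds iff (0) `AprioriCeilingAt 1` and, for every pinned
(`Λ = 8`, `θ = 6/5`) rigid quiet wide schedule `S` and every globally anchored registered level-1 stage `s`, every
classical solution `(w, r)` of the UNFORCED system on `[0, τ₂ − τ₁]` with `w 0 = s.u τ₁`, of finite energy and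
`≤ c₂·Y₂` there, has at time `τ₂ − τ₁`, in the ball `‖x‖ ≤ radius`, (1) a point of speed `≥ c₁·Y₂`, (2) a point of
strain `≥ c₁·A₂`, (3) a level-2 core loop. [cite: Palasek2026ElementaryModel, §4] -/
theorem palasekTowerBreakdown_heredityAtOne_iff_apriori_and_sliceFloors :
    PalasekTowerBreakdown.HeredityAtOne ↔
      AprioriCeilingAt 1 ∧
      (∀ S : Schedule TowerRates.wide, S.Pins 8 (6 / 5) → S.Rigid → S.Quiet →
        ∀ s : Stage 1 TowerRates.wide S (Margins.routeG TowerRates.wide) 1,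
          SliceRun S 1 (fun S v => ∃ x, ‖x‖ ≤ S.radius ∧ S.c₁ * TowerRates.wide.Y 2 ≤ ‖v x‖) (s.u (S.τ 1))) ∧
      (∀ S : Schedule TowerRates.wide, S.Pins 8 (6 / 5) → S.Rigid → S.Quiet →
        ∀ s : Stage 1 TowerRates.wide S (Margins.routeG TowerRates.wide) 1,
          SliceRun S 1 (fun S v => ∃ x, ‖x‖ ≤ S.radius ∧ S.c₁ * TowerRates.wide.A 2 ≤ ‖fderiv ℝ v x‖)
            (s.u (S.τ 1))) ∧
      (∀ S : Schedule TowerRates.wide, S.Pins 8 (6 / 5) → S.Rigid → S.Quiet →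
        ∀ s : Stage 1 TowerRates.wide S (Margins.routeG TowerRates.wide) 1,
          SliceRun S 1 (fun S v => ∃ (x : EuclideanSpace ℝ (Fin 3)) (γ : ℝ → EuclideanSpace ℝ (Fin 3)),
            ‖x‖ ≤ S.radius ∧ ContDiff ℝ 1 γ ∧ γ 0 = γ 1 ∧
            (∀ σ ∈ Icc (0 : ℝ) 1, γ σ ∈ Metric.closedBall x (1 / TowerRates.wide.N 2)) ∧
            (∀ σ ∈ Icc (0 : ℝ) 1, ‖deriv γ σ‖ ≤ 8 * π / TowerRates.wide.N 2) ∧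
            S.c₁ * TowerRates.wide.N 2 ^ (TowerRates.wide.β - 2) ≤ circulation v γ) (s.u (S.τ 1))) := by
  unfold PalasekTowerBreakdown.HeredityAtOne
  rw [heredityAtOne_iff_apriori_speed_strain_core, speedFloorAt_iff_sliceRun le_rfl,
    strainFloorAt_iff_sliceRun le_rfl, coreFloorAt_iff_sliceRun le_rfl]

/-- **Under the item, every tame free run from a registered level-1 slice ends with the level-2 LETTER**
(route decl by name; `readoutFloorsAt_one_iff_sliceRun`). [cite: Palasek2026ElementaryModel, §4] -/
theorem palasekTowerBreakdown_heredityAtOne_sliceLetter (h : PalasekTowerBreakdown.HeredityAtOne) :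
    ∀ S : Schedule TowerRates.wide, S.Pins 8 (6 / 5) → S.Rigid → S.Quiet →
      ∀ s : Stage 1 TowerRates.wide S (Margins.routeG TowerRates.wide) 1,
        SliceRun S 1 (fun S v => Letter S 2 v) (s.u (S.τ 1)) := by
  unfold PalasekTowerBreakdown.HeredityAtOne at h
  exact readoutFloorsAt_one_iff_sliceRun.1 h.readoutFloorsAt

/-- **Refutation template, slice form, by name**: ONE pinned rigid quiet wide schedule, ONE registered level-1
stage, ONE unforced finite-energy classical run on `[0, τ₂ − τ₁]` from its slice `s.u τ₁` staying `≤ c₂·Y₂`, whose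
terminal slice is NOT a level-2 letter in the ball, refute `PalasekTowerBreakdown.HeredityAtOne`. Vacuity warning:
no registered level-1 stage is known (item 19179 open). [cite: Palasek2026ElementaryModel, §4] -/
theorem palasekTowerBreakdown_not_heredityAtOne_of_lazy_slice
    (hW : ∃ (S : Schedule TowerRates.wide) (s : Stage 1 TowerRates.wide S (Margins.routeG TowerRates.wide) 1)
      (w : ℝ → EuclideanSpace ℝ (Fin 3) → EuclideanSpace ℝ (Fin 3)) (r : ℝ → EuclideanSpace ℝ (Fin 3) → ℝ),
      S.Pins 8 (6 / 5) ∧ S.Rigid ∧ S.Quiet ∧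
      IsClassicalNSSolutionOn (Icc 0 (S.τ 2 - S.τ 1)) 1 0 w r ∧ w 0 = s.u (S.τ 1) ∧
      (∃ C : ℝ≥0∞, C < ⊤ ∧ ∀ σ ∈ Icc 0 (S.τ 2 - S.τ 1), ∫⁻ x, ‖w σ x‖ₑ ^ 2 ≤ C) ∧
      (∀ σ ∈ Icc 0 (S.τ 2 - S.τ 1), ∀ x, ‖w σ x‖ ≤ S.c₂ * TowerRates.wide.Y 2) ∧
      ¬ Letter S 2 (w (S.τ 2 - S.τ 1))) :
    ¬ PalasekTowerBreakdown.HeredityAtOne := by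
  intro h
  obtain ⟨S, s, w, r, hP, hR, hQ, hw, hw0, hE, hB, hnot⟩ := hW
  exact hnot (palasekTowerBreakdown_heredityAtOne_sliceLetter h S hP hR hQ s w r hw hw0 hE hB)

/-- **The item from no overshoot, the speed and strain stubs, and the FLUX FORM of the core stub**: if every tame
continuation of every registered level-1 stage carries at `τ₂` a disc of radius `1/N₂` centred in the ball, in an
orthonormal frame, with normal vorticity `≥ c₁·A₂/(4π)` throughout, then `CoreFloorAt 1`
(`coreFloorAt_one_of_vorticityDisc`), and with `AprioriCeilingAt 1`, `SpeedFloorAt 1`, `StrainFloorAt 1` the item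
follows. [cite: MajdaBertozziCUP2002, §1.6] -/
theorem palasekTowerBreakdown_heredityAtOne_of_apriori_speed_strain_vorticityDisc (hA : AprioriCeilingAt 1)
    (h₁ : SpeedFloorAt 1) (h₂ : StrainFloorAt 1)
    (h₃ : ReadoutAt 1 (fun S v => ∃ x e₁ e₂ : EuclideanSpace ℝ (Fin 3),
      ‖x‖ ≤ S.radius ∧ ‖e₁‖ = 1 ∧ ‖e₂‖ = 1 ∧ ⟪e₁, e₂⟫ = 0 ∧
      ∀ ρ ∈ Icc 0 (1 / TowerRates.wide.N 2), ∀ θ : ℝ,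
        S.c₁ * TowerRates.wide.A 2 / (4 * π) ≤
          ⟪curl v (x + (ρ * cos θ) • e₁ + (ρ * sin θ) • e₂), cross e₁ e₂⟫)) :
    PalasekTowerBreakdown.HeredityAtOne := by
  unfold PalasekTowerBreakdown.HeredityAtOne
  exact heredityAtOne_of_apriori_floors hA h₁ h₂ (coreFloorAt_one_of_vorticityDisc h₃)

end Summit.NavierStokesRegularity.NavierStokesRegularity.Theorems
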